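import Summits.CriticalPhenomena.SAWScalingLimit.Theses.SAWCircleScreening
import Summits.CriticalPhenomena.SAWScalingLimit.Theses.SAWConfRestriction
import Summits.CriticalPhenomena.SAWScalingLimit.Theses.SAWEdgeOfPositiveType
import Summits.CriticalPhenomena.SAWScalingLimit.Theorems.SAWRenewalTightnessTightIdentificationGlue
import Literature.Probability.RandomPlanarGeometry.SAWScalingLimitFamily
import Literature.Probability.RandomPlanarGeometry.LocalMartingaleProofs
import HarnessLib.Audit

/-!
# Crux `SomeApproxLimit` (stmt-CriticalPhenomena-5466) — birth skeleton `Lines/birth.lean`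

Route `SAWCircleScreening` (sub-problem `SAWScalingLimit`), crux BY NAME:
`Summit.CriticalPhenomena.SAWScalingLimit.Theses.SAWCircleScreening.SomeApproxLimit` —
(I₁) "one endpoint convention converges": for every Dobrushin domain `D` there EXIST endpoint
approximations `(a, b)` (`SAW.IsEndpointApprox D a b`) along which the critical `δℤ²` SAW law, pushed
to `CurveClass ℂ`, converges in law to chordal SLE_{8/3} (`ConvergesInLawToSLE (8/3)`).  In the route
this is the identification INPUT (rank 6, deliberately the weakest form; the route's own mechanism is
the circle-screen coupling `EndpointCoupling` that transports ONE convention to ALL conventions).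

## The line (the standard tightness/identification seam, cut where the `∃` of the crux sits)

Every printed convergence-to-SLE proof ends with the same soft step (Duminil-Copin–Smirnov 2012,
proof of Thm 3.13: "the family of curves is tight … any sub-sequential limit … is SLE(κ) … the possible
limit being unique, the claim is proved"; Billingsley 1999 Thm 5.1 + Corollary), PROVED in tree for the
SAW laws, which are probability measures only past the junk meshes
(`Theorems.saw_convergesInLawToSLE_of_isTightAlongMesh`: Prokhorov on the Polish space `CurveClass ℂ`,
subsequence principle along the countably generated filter `𝓝[>] 0`, uniqueness of the chordal
SLE_{8/3} law `IsSLECurve.map_eq_holds`).  So `SomeApproxLimit` = (a-priori bounds) + (identification of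
subsequential limits along ONE convention per domain):

* `stub_eventualTight` — (T) EVENTUAL TIGHTNESS along the mesh of the pushed critical SAW laws, for every
  Dobrushin domain and endpoint approximation: VERBATIM the shared item stmt-CriticalPhenomena-1881
  (`SAWConfRestriction.EventualTight`, the `IsTightAlongMesh` form wanted by SAWParafermion /
  SAWConfRestriction / SAWLeftRightFKG / SAWAsymptoticMorera / SAWExcursionCardy / …; `Iff.rfl` pin below).
  It is the `∀ᶠ δ` repair of the REFUTED all-`δ` statement stmt-CriticalPhenomena-0772 and is implied by
  the set-level form stmt-CriticalPhenomena-1372 (`isTightAlongMesh_of_eventualTight`, tree).  OPEN: no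
  annulus-crossing / Kemppainen–Smirnov G2 bound for the `x_c`-SAW (no RSW/FKG).  Tightness technology
  (Aizenman–Burchard, KS) is insensitive to the endpoint convention, which is why the universal
  quantifier over approximations sits HERE and not in (I∃).
* `stub_someConventionIdentified` — (I∃) IDENTIFICATION ALONG ONE CONVENTION: for every Dobrushin domain
  there EXIST endpoint approximations `(a, b)` such that every probability measure `μ` on `CurveClass ℂ`
  that is a weak limit of the pushed laws along a mesh sequence `sₙ → 0⁺` is the chordal SLE_{8/3} law
  of `D` (`IsSLELaw (8/3) D μ`).  This is the `∃`-over-conventions weakening of the shared crux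
  stmt-CriticalPhenomena-0783 (`SubseqIdentification`, ∀ approximations; proved implication
  `someConventionIdentified_of_subseqIdentification` below via `SAW.exists_isEndpointApprox`) — exactly
  the freedom the crux grants: the identification route may CHOOSE its convention (boundary vertices,
  where parafermionic / Kennedy–Lawler observables live; nearest vertices as in LSW04 §3.4.2).  OPEN (the
  LSW04 Prediction 1 / DCS12 Conjecture 1 identification; no `ℤ²` observable).  It is a CONSEQUENCE of the
  crux (`someConventionIdentified_of_someApproxLimit`, proved below: weak limits along `𝓝[>] 0` are unique),
  hence exactly as safe as the crux, and strictly weaker than it (it says nothing when mass escapes: no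
  tightness).

`SomeApproxLimit_of (hT : Registered.stub_eventualTight) (hI : Registered.stub_someConventionIdentified) :
SomeApproxLimit` is PROVED (no sorry): per domain take the convention of (I∃), tightness along it from
(T), and run `Theorems.saw_convergesInLawToSLE_of_isTightAlongMesh` with the identification read through
`IsSubseqLimitLaw`.

Why only two stubs.  Exactly one stub can carry the `∃` over conventions (two existential stubs cannot
share their witness; a convention-universal identification or uniqueness stub would be as strong as the
route's other crux `EndpointCoupling` at non-geometric conventions — dilation/translation covariance of a
one-convention limit needs approximation-robustness).  The convention-insensitive input (tightness) is
universal and shared; everything convention-sensitive (existence of the limit along the convention and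
its identification) is the one existential stub, as in the crux.

Sorries: exactly 2 = the two `stub_*`; zero elsewhere.  Disproof used: none (no `Disproof.lean` on
stmt-5466; `ledger crux ls` shows no workfiles).  Negatives honoured: stmt-0772 (all-`δ` `IsTightLaws`,
refuted by `SAWParafermionTight_refuted`) is NOT used — (T) is its eventual repair stmt-1881.
BC3 probes (planner folder `bc/probe_{T,I}_{crux,summit}.lean`): `stub → SomeApproxLimit` and
`stub → SAWScalingLimit` by `first | exact? | simpa | aesop` FAIL for both stubs.
-/

noncomputable section

open MeasureTheory Filter Topology Set
open Literature.Probability.RandomPlanarGeometry Literature.Probability.RandomPlanarGeometry.SAW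
open Literature.Probability.LatticeModels
open scoped ENNReal NNReal BoundedContinuousFunction Topology

namespace Summit.CriticalPhenomena.SAWScalingLimit.Cruxes.SomeApproxLimit.Birth

open Summit.CriticalPhenomena.SAWScalingLimit.Theses.SAWCircleScreening (SomeApproxLimit)

/-! ## The registered stubs -/

/-- **stub (T) — EVENTUAL TIGHTNESS ALONG THE MESH** (verbatim the shared item
stmt-CriticalPhenomena-1881, `SAWConfRestriction.EventualTight`): for every Dobrushin domain and every
endpoint approximation, the pushed-forward critical SAW laws are tight as `δ → 0⁺` (`IsTightAlongMesh`:
for every `ε` one compact set of `CurveClass ℂ` carries all but `ε` of the mass for all small `δ`).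
OPEN: needs an annulus-crossing / Condition-G2 bound for the critical SAW (Aizenman–Burchard regularity;
KS17 §4 verifies G2 only for FKG models); the all-`δ` form stmt-0772 is refuted, this eventual form misses
its witness.  Sources: KemppainenSmirnov2017 Thm 1.5 / Cor 1.7, AizenmanBurchardDuke1999 Thm 1.1–1.2,
DuminilCopinHammond2013 Thm 1.1, LawlerSchrammWerner2004SAW §3.4.2. -/
theorem stub_eventualTight : ∀ (D : Literature.Probability.RandomPlanarGeometry.DobrushinDomain) (a b : ℝ → Literature.Probability.LatticeModels.Site 2), Literature.Probability.RandomPlanarGeometry.SAW.IsEndpointApprox D a b → Literature.Probability.RandomPlanarGeometry.IsTightAlongMesh (fun δ (γ : Literature.Probability.RandomPlanarGeometry.SAW.DomainSAW D.carrier δ (a δ) (b δ)) => γ.curve) (fun δ => Literature.Probability.RandomPlanarGeometry.SAW.law D.carrier δ (a δ) (b δ)) := by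
  sorry

/-- **stub (I∃) — IDENTIFICATION OF SUBSEQUENTIAL LIMITS ALONG ONE CONVENTION** (new; the
`∃`-over-conventions weakening of the shared crux stmt-CriticalPhenomena-0783 `SubseqIdentification`):
for every Dobrushin domain `D` there exist endpoint approximations `(a, b)` (`IsEndpointApprox D a b`)
such that every probability measure `μ` on `CurveClass ℂ` with `∫ f∘curve dP_{sₙ} → ∫ f dμ` for all bounded
continuous `f` along some mesh sequence `sₙ → 0⁺` is the chordal SLE_{8/3} law of `D`
(`IsSLELaw (8/3) D μ`).  The identification route chooses the convention (boundary vertices for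
observables / Kennedy–Lawler densities; nearest vertices as in LSW04).  OPEN: LSW04 Prediction 1 /
DCS12 Conjecture 1 for one convention (no discrete-holomorphic observable on `ℤ²`; restriction route needs
conformal covariance of the limit).  A consequence of the crux (`someConventionIdentified_of_someApproxLimit`).
Sources: LawlerSchrammWerner2004SAW §3.4.2 and Prediction 1 (§4.1), LawlerSchrammWerner2003Restriction
Thm 6.1 / Cor 8.6, DuminilCopinSmirnov2012 Conj. 1, KennedyLawler2013 §1, stmt-CriticalPhenomena-0783. -/
theorem stub_someConventionIdentified : ∀ D : Literature.Probability.RandomPlanarGeometry.DobrushinDomain, ∃ a b : ℝ → Literature.Probability.LatticeModels.Site 2, Literature.Probability.RandomPlanarGeometry.SAW.IsEndpointApprox D a b ∧ ∀ (s : ℕ → ℝ) (μ : MeasureTheory.Measure (Literature.Probability.RandomPlanarGeometry.CurveClass ℂ)), Filter.Tendsto s Filter.atTop (nhdsWithin 0 (Set.Ioi 0)) → MeasureTheory.IsProbabilityMeasure μ → (∀ f : BoundedContinuousFunction (Literature.Probability.RandomPlanarGeometry.CurveClass ℂ) ℝ, Filter.Tendsto (fun n => ∫ γ, f γ.curve ∂(Literature.Probability.RandomPlanarGeometry.SAW.law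 D.carrier (s n) (a (s n)) (b (s n)))) Filter.atTop (nhds (∫ x, f x ∂μ))) → Literature.Probability.RandomPlanarGeometry.IsSLELaw ((8 : NNReal) / 3) D μ := by
  sorry

/-! ## Name-keyed aliases of the stub statements (skeleton-check convention: the hypotheses of
`SomeApproxLimit_of` are exactly the declared stubs, each BY NAME) -/

namespace Registered

/-- Alias keyed by the stub name: the statement of `stub_eventualTight` (= item stmt-1881). -/
abbrev stub_eventualTight : Prop :=
  ∀ (D : Literature.Probability.RandomPlanarGeometry.DobrushinDomain) (a b : ℝ → Literature.Probability.LatticeModels.Site 2), Literature.Probability.RandomPlanarGeometry.SAW.IsEndpointApprox D a b → Literature.Probability.RandomPlanarGeometry.IsTightAlongMesh (fun δ (γ : Literature.Probability.RandomPlanarGeometry.SAW.DomainSAW D.carrier δ (a δ) (b δ)) => γ.curve) (fun δ => Literature.Probability.RandomPlanarGeometry.SAW.law D.carrier δ (a δ) (b δ))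

/-- Alias keyed by the stub name: the statement of `stub_someConventionIdentified` (new). -/
abbrev stub_someConventionIdentified : Prop :=
  ∀ D : Literature.Probability.RandomPlanarGeometry.DobrushinDomain, ∃ a b : ℝ → Literature.Probability.LatticeModels.Site 2, Literature.Probability.RandomPlanarGeometry.SAW.IsEndpointApprox D a b ∧ ∀ (s : ℕ → ℝ) (μ : MeasureTheory.Measure (Literature.Probability.RandomPlanarGeometry.CurveClass ℂ)), Filter.Tendsto s Filter.atTop (nhdsWithin 0 (Set.Ioi 0)) → MeasureTheory.IsProbabilityMeasure μ → (∀ f : BoundedContinuousFunction (Literature.Probability.RandomPlanarGeometry.CurveClass ℂ) ℝ, Filter.Tendsto (fun n => ∫ γ, f γ.curve ∂(Literature.Probability.RandomPlanarGeometry.SAW.law D.carrier (s n) (a (s n)) (b (s n)))) Filter.atTop (nhds (∫ x, f x ∂μ))) → Literature.Probability.RandomPlanarGeometry.IsSLELaw ((8 : NNReal) / 3) D μ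

end Registered

/-! ## The composition: the crux BY NAME from the two stubs -/

/-- **`SomeApproxLimit` from (T) and (I∃).**  For each Dobrushin domain `D` take the convention `(a, b)`
of (I∃); the pushed critical SAW laws along it are tight along the mesh by (T); every probability
subsequential limit law along it is the chordal SLE_{8/3} law by (I∃) (read through `IsSubseqLimitLaw`);
the tree's criterion `saw_convergesInLawToSLE_of_isTightAlongMesh` (Prokhorov past the junk meshes +
subsequence principle along `𝓝[>] 0` + uniqueness of the SLE_{8/3} law) gives `ConvergesInLawToSLE (8/3)`
along `(a, b)`.  [cite: BillingsleyCPM1999, Thm. 5.1, Corollary] [cite: DuminilCopinSmirnov2012, proof of Thm. 3.13] -/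
theorem SomeApproxLimit_of (hT : Registered.stub_eventualTight)
    (hI : Registered.stub_someConventionIdentified) :
    Summit.CriticalPhenomena.SAWScalingLimit.Theses.SAWCircleScreening.SomeApproxLimit := by
  intro D
  obtain ⟨a, b, hab, hId⟩ := hI D
  refine ⟨a, b, hab, ?_⟩
  refine Summit.CriticalPhenomena.SAWScalingLimit.Theorems.saw_convergesInLawToSLE_of_isTightAlongMesh
    hab (hT D a b hab) ?_
  rintro μ hμ ⟨s, hs, hlim⟩
  exact hId s μ hs hμ hlim

/-- Wiring check: the crux BY NAME from the two registered (sorried) stubs — the stub theorems are exactly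
the hypotheses of `SomeApproxLimit_of` (this declaration inherits their `sorry`; nothing is claimed). -/
theorem SomeApproxLimit_wiring :
    Summit.CriticalPhenomena.SAWScalingLimit.Theses.SAWCircleScreening.SomeApproxLimit :=
  SomeApproxLimit_of stub_eventualTight stub_someConventionIdentified

/-! ## Pins (documentation): (T) IS the shared item; (I∃) sits between the shared crux 0783 and the crux -/

/-- (T) is verbatim the shared item `SAWConfRestriction.EventualTight` (stmt-CriticalPhenomena-1881). -/
theorem stub_eventualTight_iff_item1881 :
    Registered.stub_eventualTight ↔
      Summit.CriticalPhenomena.SAWScalingLimit.Theses.SAWConfRestriction.EventualTight :=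
  Iff.rfl

/-- (I∃) is implied by the shared crux `SubseqIdentification` (stmt-CriticalPhenomena-0783, identification
along EVERY approximation): take any endpoint approximation (`SAW.exists_isEndpointApprox`, tree). -/
theorem someConventionIdentified_of_subseqIdentification
    (h : Summit.CriticalPhenomena.SAWScalingLimit.Theses.SAWEdgeOfPositiveType.SubseqIdentification) :
    Registered.stub_someConventionIdentified := by
  intro D
  obtain ⟨a, b, hab⟩ := SAW.exists_isEndpointApprox D
  exact ⟨a, b, hab, h D a b hab⟩

/-- Sanity (necessity of (I∃)): under the crux, along the converging convention every probability
subsequential limit IS the SLE_{8/3} law — weak limits of the same sequence of integrals are unique and a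
finite Borel measure on a metric space is determined by its integrals of bounded continuous functions.
So (I∃) is a CONSEQUENCE of `SomeApproxLimit`. [cite: BillingsleyCPM1999, Thm. 1.2] -/
theorem someConventionIdentified_of_someApproxLimit
    (h : Summit.CriticalPhenomena.SAWScalingLimit.Theses.SAWCircleScreening.SomeApproxLimit) :
    Registered.stub_someConventionIdentified := by
  intro D
  obtain ⟨a, b, hab, Γ, hΓ, -, hT⟩ := h D
  refine ⟨a, b, hab, fun s μ hs hμ hlim => ?_⟩
  haveI := isProbabilityMeasure_preWienerMeasure'
  haveI : IsProbabilityMeasure (Literature.Probability.Process.preWienerMeasure.map Γ) :=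
    Measure.isProbabilityMeasure_map hΓ.aemeasurable
  have hμeq : μ = Literature.Probability.Process.preWienerMeasure.map Γ := by
    refine ext_of_forall_integral_eq_of_IsFiniteMeasure fun f => ?_
    have h1 := hlim f
    have h2 : Tendsto (fun n => ∫ γ, f γ.curve ∂(law D.carrier (s n) (a (s n)) (b (s n)))) atTop
        (𝓝 (∫ x, f x ∂(Literature.Probability.Process.preWienerMeasure.map Γ))) := by
      rw [integral_map hΓ.aemeasurable f.continuous.aestronglyMeasurable]
      exact (hT f).comp hs
    exact tendsto_nhds_unique h1 h2
  rw [hμeq]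
  exact hΓ.isSLELaw_map

end Summit.CriticalPhenomena.SAWScalingLimit.Cruxes.SomeApproxLimit.Birth
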